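import Summits.BirchSwinnertonDyer.Rank1Residual.ManinAdditive.JumpDegreeLaws
import Summits.BirchSwinnertonDyer.Rank1Residual.ManinAdditive.TameCellLocalTwoTorsion
import HarnessLib
import HarnessLib.Audit.Tags

/-!
# es g36 (cell bsd-f2-manin, MEMO-es §57.11) — THEOREM L♮: the Atkin–Lehner fixed-point / discriminant-field law

**Row E-es-173 `ALFixedPointDiscriminantLaw`** (THEOREM CANDIDATE with a complete paper proof, MEMO-es §57.11; typed as an
`@[conjecture]` node because the tree has no Atkin–Lehner group action / CM points on `X₀(N)` yet).

STATEMENT.  Let `φ : X₀(N) → E` be any modular parametrisation, `ε : W → {±1}` the Atkin–Lehner sign character of the newform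
`f`.  Suppose (i) `E(ℚ)[2] = 0`; (ii) `Δ_E ∉ ℚ²` (so `Gal(ℚ(E[2])/ℚ) ≅ S₃`); (iii) for every exact divisor `Q ∥ N`, `Q > 1`, with
`w_Q f = −f`: `ℚ(√Δ_E) ≠ ℚ(√−Q)` (i.e. `−Q·Δ_E ∉ ℚ²`), and if `Q = 2` also `ℚ(√Δ_E) ≠ ℚ(i)`.  THEN `2^{ω(N)} ∣ deg φ`
(`ω(N)` = number of prime factors of `N`).

PROOF SKETCH (MEMO-es §57.11.2).  (1) `φ ∘ w = ε(w)φ + P_w`, `P_w ∈ E(ℚ)`; `ε(w) = 1 ⟹ 2P_w = 0 ⟹ P_w = 0` by (i), so `φ`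
factors through `C = X₀(N)/W⁺`, `W⁺ = ker ε`; if `ε ≡ 1`, `|W⁺| = 2^{ω}` and we are done; else `|W⁺| = 2^{ω−1}`, `φ = φ♭∘π`.
(2) any `w' ∉ W⁺` induces an involution `ι ≠ id` of `C` with `φ♭∘ι = −φ♭ + P`; the half-points `{u : 2u = P}` contain exactly one
rational point `Q` (cusps ↦ torsion, `E(ℚ)_tors` odd) and the other three form ONE Galois orbit (cubic irreducible by (i)).
(3) THEOREM A♯: `deg φ♭ ≡ #F_u (mod 2)`, `F_u = {x ∈ Fix ι : φ♭(x) = u}` (fibres pair off under `ι`; at an `ι`-fixed point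
`φ♭` is odd in adapted coordinates, so its ramification index is odd).  (4) Galois permutes `F_{Q+T₁}, F_{Q+T₂}, F_{Q+T₃}`
transitively (common size `m`) and `#Fix ι` is even (Riemann–Hurwitz), so `deg φ♭ ≡ #F_Q ≡ m (mod 2)`.  (5) `x ∈ F_{Q+Tᵢ}`
forces `ℚ(Tᵢ) ⊂ ℚ(x) ⊂ ℚ(y)` for a lift `y ∈ Fix(w_Q)`, `ε(w_Q) = −1`; fixed points of `w_Q` on `X₀(N)` are cusps (fields
`⊂ ℚ(ζ_N)`) or CM points whose order contains a primitive element of norm `Q` and trace `≡ 0 (mod Q)`, hence of trace `0`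
(`|t| < 2√Q`) — CM field `ℚ(√−Q)` — or, for `Q = 2`, trace `±2` — CM field `ℚ(i)`; CM points of `X₀(N)` are rational over
`K^{ab}` (CM theory).  A non-Galois cubic field inside `K^{ab}` (Galois over `ℚ`, abelian over `K`) has Galois closure
containing `K`, so `K = ℚ(√Δ_E)`, excluded by (iii); inside `ℚ^{ab}` there is none.  Hence `m = 0`, `deg φ♭` even. ∎

CENSUS (BC5; every parametrisation at conductor level, Cremona `N < 5·10⁵`, `E(ℚ)[2] = 0`, hypotheses (ii)(iii) evaluated
with `ε_q = −a_q` for `q ∥ N` (split ⟺ `−c₆ ∈ ℚ_q^{×2}`) and `ε₄ = −1` for `4 ∥ N`; levels `N`, `2N′`, `4N′` with `N′` odd squarefree —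
other additive levels are untestable from `a_q` and excluded): hypothesis holds ⟹ `2^{ω(N)} ∣ deg φ` in 100 706 / 100 706 (`N` squarefree)
+ 193 096 / 193 096 (`2 ∥ N`) + 19 185 / 19 185 (`4 ∥ N`, the tame cell) = 312 987 / 312 987 cases, 0 exceptions (engine census11.py
9b14829ae3c08c4a, table out-census11-500000.txt 5ea25444d9e0ea9c; cell-only census10.py 1463014ee841a4ac / out-census10-500000.txt
596e599f3b9df9a1); the SHARP form E-es-173⁺ (only sign-`−1` divisors whose involution has a fixed point constrain the field):
122 589 + 233 660 + 40 946 = 397 195 / 397 195, 0 exceptions (census12.py a167075e07a35786 / out-census12-500000.txt 27cb503a0dcf3307);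
the complementary class (`ℚ(√Δ_E)` IS such a CM field) is mixed — 105 329 with / 14 777 without `2^{ω(N)} ∣ deg φ` — and contains every
curve of the table with `v₂(deg φ) < ω(N)`.
NUMERICAL CHECK OF THE MECHANISM (heegner_parity.py 0fec1b75e640c5d5 → out-heegner-parity.txt 9c85729b1fd8ca8e, rank 0, 7 curves;
heegner_parity_plus2.py 3488f642dcd1e016 → out-heegner-parity-plus.txt 8d15d3ea41c834ac, odd rank, 13 curves; `N = 4p`): the sign-`−1`
Atkin–Lehner-fixed CM points (inventories checked against Riemann–Hurwitz) map into ONE `E[2]`-torsor of half-points (deviation `< 10⁻¹²`),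
split EQUALLY `m : m : m` over the three non-rational half-points, and `deg φ♭ ≡ m (mod 2)` in 20 / 20 cases; `m = 0` whenever (iii) holds
(316a1, 316b1, 148a1, 404a1) and also for the IV* curves 172a1, 172a2, 524a1 (where (iii) fails: the E-es-171♯ habitat), `m` odd for
44a1, 76a1, 92a1, 124b1, 268a1 (rank 0) and 92b1, 124a1, 124a2, 236a1, 428b1, 556a1 (odd rank, Kodaira IV), `m = 2` for 116b1.
PLACEMENT.  Step (1) is Dummigan–Krishnamoorthy 2013, Prop. 2.1 (as quoted in Bhakta–Krishnamoorthy–Pasupulati, arXiv:2308.13708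
§2.5); the odd-degree corollary «`deg φ` odd ⟹ rational 2-torsion or `ℚ(E[2])` totally complex» is consistent with
Calegari–Emerton 2009 Thm 1.1(3); whether the `2^{ω(N)}` statement with the resolvent-field hypothesis (iii) is in
Dummigan–Krishnamoorthy 2013 (JNT 133, not held: acq-02291) is OPEN — flagged for the referee seat (R-es-84).
PARTITION: candidate +1 (beyond-print theorem: CANDIDATE pending acq-02291 and referee audit) · BSD is not proved by this;
Manin's conjecture is not proved by this.

TYPER NOTE (typer g21, T-es-68, file 2/2 «Sketch-c»).  SOURCE = HOME/es/g36/Sketch-es-g36c.lean sha16 0c5b13c60d103016 (175 l.; es: farm rc 0, BC7 3/3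
CLEAN; MEMO-es §57.11 = THEOREM L♮, HOME/es/g36/MEMO-es-sec57-11.md; census 312 987/312 987 (sharp 397 195/397 195), 0 FAIL) VERBATIM but for four
typer deltas: (i) the import `Theorems.ManinLocalTwoThreeFourPRootNumberMinusOne` is DROPPED with its `open …Theorems.ManinLocalTwoThree` line — that
module lies INSIDE the `Theses.ManinLocalTwoThree` import cone and NOTHING in this file uses it (typer grep of its declarations: 0 hits), so the file is
route-independent as landed; (ii) namespace `…ManinAdditive.EsG36` → `…ManinAdditive.AtkinLehnerDegree` (named for the mathematics; shared with file 1/2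
`AtkinLehnerDegreeLaws.lean`); (iii) a one-line docstring on `four_dvd_of_two_pow_card_primeFactors_dvd` (gate lint); (iv) this note.  Imports: landed
`…ManinAdditive.JumpDegreeLaws` + `…ManinAdditive.TameCellLocalTwoTorsion` + HarnessLib(+Audit.Tags).  DEFINITIONS (real, with bodies):
`DiscFieldAvoidsFixedPointCMFields`, `ALInvolutionHasFixedPoint`.  ROWS (es's `@[conjecture]` tags, nothing asserted): **E-es-173 `ALFixedPointDiscriminantLaw`**
(THEOREM CANDIDATE L♮, complete paper proof in MEMO-es §57.11; typed as a node only because the tree lacks the Atkin–Lehner group action / CM points on X₀(N)),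
**E-es-173♭ `ALPlusKernelFullLaw`**, **E-es-173⁺ `ALFixedPointDiscriminantLawSharp`**; PROVED `aLFixedPointDiscriminantLaw_of_sharp`,
`four_dvd_of_two_pow_card_primeFactors_dvd`, `four_dvd_modularDegree_of_ALFixedPointDiscriminantLaw`, `two_dvd_modularDegree_of_ALFixedPointDiscriminantLaw`.
REFUTER: ref1/ref2 R-es-84 PENDING at landing.  9 decl names fresh; cite key AtkinLehner1970 present; no instances, no notation, no sorry.  `--supports`
refused for ManinAdditive ⇒ bears_on: stmt-BirchSwinnertonDyer-22967 (C2 `ManinOddAtFour`).  BSD is not proved by this; C2 OPEN.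
-/

open scoped MatrixGroups ModularForm

open CongruenceSubgroup WeierstrassCurve
open Literature.NumberTheory.EllipticCurves Literature.NumberTheory.EllipticCurves.ModularForms

open Summit.BirchSwinnertonDyer.Rank1Residual.ManinAdditive.ConwayCut
open Summit.BirchSwinnertonDyer.Rank1Residual.ManinAdditive.JumpDegree
open Summit.BirchSwinnertonDyer.Rank1Residual.ManinAdditive.TameTwoLocal

namespace Summit.BirchSwinnertonDyer.Rank1Residual.ManinAdditive.AtkinLehnerDegree

/-- The discriminant-field hypothesis (iii) of THEOREM L♮ at one exact divisor `Q`: `ℚ(√Δ) ≠ ℚ(√−Q)`, and `≠ ℚ(i)` when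
`Q = 2` (the CM fields of the non-cuspidal fixed points of `w_Q`).  [folklore] -/
def DiscFieldAvoidsFixedPointCMFields (W : WeierstrassCurve ℚ) (Q : ℕ) : Prop :=
  ¬ IsSquare (-(Q : ℚ) * W.Δ) ∧ (Q = 2 → ¬ IsSquare (-W.Δ))

/-- **Row E-es-173 `ALFixedPointDiscriminantLaw`** (THEOREM L♮; statement, proof sketch, census and placement in the module
docstring).  General level `N`, any parametrisation `D`.
Why it might fail: only through a gap in step (5) (field of definition of `w_Q`-fixed CM points) — none known; census 0 exceptions.
[cite: AtkinLehner1970, Thm. 3 (w_Q eigenvalues ±1 on newforms); the law is the cell's E-es-173, proof MEMO-es §57.11; cf. Dummigan–Krishnamoorthy 2013 doi:10.1016/j.jnt.2012.08.024 (not held, acq-02291) for step (1)] -/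
@[conjecture]
def ALFixedPointDiscriminantLaw : Prop :=
  ∀ (W : WeierstrassCurve ℚ) [W.IsElliptic] [W.IsGloballyMinimal] {N : ℕ} [NeZero N]
    (D : ModularParametrizationData W N), W.conductorNorm ℤ = N →
    ¬ HasRationalTwoTorsion W → ¬ IsSquare W.Δ →
    (∀ (Q : ℕ) [NeZero Q], Q ∣ N → 1 < Q → Nat.Coprime Q (N / Q) →
        atkinLehnerInvolution N 2 Q D.f = -D.f → DiscFieldAvoidsFixedPointCMFields W Q) →
      2 ^ N.primeFactors.card ∣ D.modularDegree

/-- **Row E-es-173♭ `ALFixedPointDiscriminantLawPlus`**: the sign-trivial case of THEOREM L♮ needs no discriminant hypothesis —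
if every `w_Q` acts by `+1` on `f` and `E(ℚ)[2] = 0` then `φ` factors through `X₀(N)/W` and `2^{ω(N)} ∣ deg φ`
(step (1) alone; Dummigan–Krishnamoorthy 2013 Prop. 2.1 territory).
Why it might fail: it is a theorem on paper (node pending the `W`-action on `X₀(N)` in the tree).
[cite: AtkinLehner1970, Thm. 3; Dummigan–Krishnamoorthy 2013 Prop. 2.1 apud arXiv:2308.13708 §2.5] -/
@[conjecture]
def ALPlusKernelFullLaw : Prop :=
  ∀ (W : WeierstrassCurve ℚ) [W.IsElliptic] [W.IsGloballyMinimal] {N : ℕ} [NeZero N]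
    (D : ModularParametrizationData W N), W.conductorNorm ℤ = N →
    ¬ HasRationalTwoTorsion W →
    (∀ (Q : ℕ) [NeZero Q], Q ∣ N → Nat.Coprime Q (N / Q) → atkinLehnerInvolution N 2 Q D.f = D.f) →
      2 ^ N.primeFactors.card ∣ D.modularDegree

/-- `w_Q` (for `Q ≥ 4`) has a fixed point in `ℍ` iff `Q·a² ≡ −1 (mod N/Q)` is solvable, iff `−Q` is a square mod `N/Q`
(MEMO-es §57.11.2, Step 5: a fixed point is the root of a level-`N` form `[Nγ, −2Qα, −β]` with `Qα² + (N/Q)βγ = −1`).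
For `Q ∈ {2, 3}` elements of trace `±2`, `±3` also occur; the sharp law keeps the field condition there unconditionally. [folklore] -/
def ALInvolutionHasFixedPoint (N Q : ℕ) : Prop :=
  Q = 2 ∨ Q = 3 ∨ IsSquare (-(Q : ZMod (N / Q)))

/-- **Row E-es-173⁺ `ALFixedPointDiscriminantLawSharp`** (THEOREM L♮⁺: the same proof; only the sign-`−1` involutions WITH a fixed point
constrain the discriminant field).  E.g. at `N = 4p`: `w_p` has fixed points iff `p ≡ 3 (mod 4)`, `w₄` iff `p ≡ 1 (mod 4)`, `w_N` always.
Census (same protocol as E-es-173): see MEMO-es §57.11.4 (table out-census12-500000.txt).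
Why it might fail: as E-es-173, plus the fixed-point criterion for composite `Q` (Step 5); census 0 exceptions.
[cite: AtkinLehner1970, Thm. 3; the law is the cell's E-es-173⁺, proof MEMO-es §57.11] -/
@[conjecture]
def ALFixedPointDiscriminantLawSharp : Prop :=
  ∀ (W : WeierstrassCurve ℚ) [W.IsElliptic] [W.IsGloballyMinimal] {N : ℕ} [NeZero N]
    (D : ModularParametrizationData W N), W.conductorNorm ℤ = N →
    ¬ HasRationalTwoTorsion W → ¬ IsSquare W.Δ →
    (∀ (Q : ℕ) [NeZero Q], Q ∣ N → 1 < Q → Nat.Coprime Q (N / Q) →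
        atkinLehnerInvolution N 2 Q D.f = -D.f → ALInvolutionHasFixedPoint N Q →
        DiscFieldAvoidsFixedPointCMFields W Q) →
      2 ^ N.primeFactors.card ∣ D.modularDegree

/-! ### Edges (proved): the law specialises to the `4 ∣ deg φ` currency of the cell and to the parity floor. -/

/-- The sharp law implies the plain one (its hypothesis asks less of the curve). -/
theorem aLFixedPointDiscriminantLaw_of_sharp (h : ALFixedPointDiscriminantLawSharp) :
    ALFixedPointDiscriminantLaw := by
  intro W _ _ N _ D hN hT hsq hQ
  exact h W D hN hT hsq (fun Q _ hQN h1 hcop hsign _ => hQ Q hQN h1 hcop hsign)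

/-- `2 ∣ N`, `N` has an odd prime factor and `2^{ω(N)} ∣ d` ⟹ `4 ∣ d` (`ω(N) ≥ 2`). (Docstring added by the typer: gate lint.) -/
theorem four_dvd_of_two_pow_card_primeFactors_dvd {N d : ℕ} (h2 : 2 ∣ N) (hodd : ∃ p, p.Prime ∧ p ∣ N ∧ p ≠ 2)
    (hN : N ≠ 0) (h : 2 ^ N.primeFactors.card ∣ d) : 4 ∣ d := by
  obtain ⟨p, hp, hpN, hp2⟩ := hodd
  have h2mem : 2 ∈ N.primeFactors := Nat.mem_primeFactors.mpr ⟨Nat.prime_two, h2, hN⟩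
  have hpmem : p ∈ N.primeFactors := Nat.mem_primeFactors.mpr ⟨hp, hpN, hN⟩
  have hcard : 2 ≤ N.primeFactors.card := by
    have : ({2, p} : Finset ℕ) ⊆ N.primeFactors := by
      intro x hx
      simp only [Finset.mem_insert, Finset.mem_singleton] at hx
      rcases hx with rfl | rfl <;> assumption
    calc 2 = ({2, p} : Finset ℕ).card := by rw [Finset.card_pair hp2.symm]
      _ ≤ N.primeFactors.card := Finset.card_le_card this
  exact dvd_trans (pow_dvd_pow 2 hcard) h

/-- THEOREM L♮ ⟹ `4 ∣ deg φ` on the tame cell for curves meeting the discriminant hypothesis (the E-facing form used by the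
cell's desc/imc currency `4 ∣ D.modularDegree`). -/
theorem four_dvd_modularDegree_of_ALFixedPointDiscriminantLaw (hL : ALFixedPointDiscriminantLaw)
    (W : WeierstrassCurve ℚ) [W.IsElliptic] [W.IsGloballyMinimal] {N : ℕ} [NeZero N]
    (D : ModularParametrizationData W N) (hN : W.conductorNorm ℤ = N) (h4 : padicValNat 2 N = 2)
    (hodd : ∃ p, p.Prime ∧ p ∣ N ∧ p ≠ 2)
    (hT : ¬ HasRationalTwoTorsion W) (hsq : ¬ IsSquare W.Δ)
    (hQ : ∀ (Q : ℕ) [NeZero Q], Q ∣ N → 1 < Q → Nat.Coprime Q (N / Q) →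
        atkinLehnerInvolution N 2 Q D.f = -D.f → DiscFieldAvoidsFixedPointCMFields W Q) :
    4 ∣ D.modularDegree := by
  have hN0 : N ≠ 0 := NeZero.ne N
  have h2 : 2 ∣ N := by
    by_contra h
    have : padicValNat 2 N = 0 := padicValNat.eq_zero_of_not_dvd h
    omega
  exact four_dvd_of_two_pow_card_primeFactors_dvd h2 hodd hN0 (hL W D hN hT hsq hQ)

/-- THEOREM L♮ ⟹ the parity floor `2 ∣ deg φ` at any level `N > 1` under its hypotheses. -/
theorem two_dvd_modularDegree_of_ALFixedPointDiscriminantLaw (hL : ALFixedPointDiscriminantLaw)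
    (W : WeierstrassCurve ℚ) [W.IsElliptic] [W.IsGloballyMinimal] {N : ℕ} [NeZero N]
    (D : ModularParametrizationData W N) (hN : W.conductorNorm ℤ = N) (h1 : 1 < N)
    (hT : ¬ HasRationalTwoTorsion W) (hsq : ¬ IsSquare W.Δ)
    (hQ : ∀ (Q : ℕ) [NeZero Q], Q ∣ N → 1 < Q → Nat.Coprime Q (N / Q) →
        atkinLehnerInvolution N 2 Q D.f = -D.f → DiscFieldAvoidsFixedPointCMFields W Q) :
    2 ∣ D.modularDegree := by
  have hne : N.primeFactors.Nonempty := by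
    rw [Finset.nonempty_iff_ne_empty, ne_eq, Nat.primeFactors_eq_empty]
    omega
  have hcard : 1 ≤ N.primeFactors.card := Finset.card_pos.mpr hne
  have h2 : (2 : ℕ) ∣ 2 ^ N.primeFactors.card := by
    calc (2 : ℕ) = 2 ^ 1 := by norm_num
      _ ∣ 2 ^ N.primeFactors.card := pow_dvd_pow 2 hcard
  exact dvd_trans h2 (hL W D hN hT hsq hQ)

end Summit.BirchSwinnertonDyer.Rank1Residual.ManinAdditive.AtkinLehnerDegree
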